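import Literature.Probability.LatticeModels.SharpLengthDCPTorus
import HarnessLib

/-!
# Duminil-Copin–Panis 2025, §2.2 with a SCREENING gain: the torus inequality and its
# infinite-volume limit when Lemma 2.5 is assumed summed over the pairs with a factor `κ`

Topic `Literature/Probability/LatticeModels`; family `crit-ising`. Theorems only (no definition, no named
fact). Companion of `SharpLengthDCPTorus.lean` (Duminil-Copin–Panis, CMP 406 (2025), arXiv:2404.05700,
§2.2): there, `DCPNearCritical.torusIneq_of_lemma25_weight` integrates the pointwise inequality
(2.20)–(2.24) (`DCPNearCritical.pointwise_master_weight`) against the sourceless current of the even torus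
and consumes **Lemma 2.5** as the PER-PAIR hypothesis `H25`; but the printed argument ("Theorem 1.2 follows
from (2.24) and Lemma 2.5") only ever uses Lemma 2.5 SUMMED over the neighbour pairs `x ∼ y` of `Λ_n`
(eq. (2.8)). This file records that weaker requirement, with an arbitrary multiplicative slack `κ ≥ 0` in
front of the summed right side (a gain `κ < 1` is what a screening improvement of Lemma 2.5 would deliver;
`κ = 1` is the printed lemma summed):

* `DCPNearCritical.torusIneq_of_lemma25_sum` — on the even torus `(ℤ/Lℤ)^d`, `L ≥ 4n + 2`:
  `1 ≤ Σ_δ ( ⟨σ_{0̄}σ_{θ_δ 0̄}⟩ + w κ Σ_{x,y ∈ Λ_n, y ∼ x} (⟨σ_{0̄}σ_{x̄}⟩ - ⟨σ_{0̄}σ_{θ_δ x̄}⟩) ⟨σ_ȳσ_{θ_δ ȳ}⟩ )`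
  (the tree's proof verbatim; only step 3, where Lemma 2.5 enters, is regrouped pairwise-to-summed);
* `DCPNearCritical.infiniteVolume_ineq_of_lemma25_sum` — its limit along the even tori `L = 2k + 2 → ∞`
  at `m*(β) = 0` (`tendsto_isingTorusTwoPoint_even`), verbatim the tree's `infiniteVolume_ineq_of_lemma25`.

Used by the `SubPtolemyFloor` line `source-cluster-screening` of `Summits/CriticalPhenomena/Ising3DConformalLimit`
(screened reflected-gradient inequality, gain `κ = C n^{-s}`).

## References

* H. Duminil-Copin, R. Panis, *New lower bounds for the (near) critical Ising and φ⁴ models' two-point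
  functions*, Comm. Math. Phys. 406 (2025), arXiv:2404.05700, §2.2 (Lemmas 2.4–2.5, eqs. (2.5)–(2.8),
  (2.20)–(2.24)) [DuminilCopinPanis2025LowerBounds] (held: `lit read arxiv:2404.05700`, chunks 9–11).
* M. Aizenman, H. Duminil-Copin, Ann. Math. 194 (2021), arXiv:1912.07973, Prop. 5.2
  [AizenmanDuminilCopinAnnals2021] (torus two-point functions converge when `m* = 0`), through
  `TorusTwoPointLimit.lean` / `SharpLengthDCPTorus.lean`.
-/


noncomputable section

open Finset Filter Topology

namespace Literature.Probability.LatticeModels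

namespace DCPNearCritical

open DCPLower
open scoped ENNReal symmDiff Classical

/-- **The torus inequality from the SUMMED Lemma 2.5 with a gain `κ`, general weight** (adapted from the
tree's `DCPNearCritical.torusIneq_of_lemma25_weight`). On the even torus `(ℤ/Lℤ)^d` (`L ≥ 4n + 2`), at
`β ≥ 0`: if the boundary input `1 ≤ w Σ_{x ∈ S} #{y ∉ S : y ∼ x} ⟨σ₀σ_x⟩_S` holds for the finite `S ∋ 0`
inside `Λ_{n-1}` and, for every direction `δ`, Lemma 2.5 of Duminil-Copin–Panis 2025 holds in current form
SUMMED over the neighbour pairs `x ∼ y` of `Λ_n` with a factor `κ ≥ 0` in front of the printed right side,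
`Σ_{x∼y} Σ_{∂𝐧 = ∅} w(𝐧) 𝟙[0̄, x̄ ∈ W_δ(𝐧), ȳ ↔ ℍ_δ] ⟨σ_{0̄}σ_{x̄}⟩_{W_δ(𝐧)} ≤ κ Σ_{x∼y} (Z(0̄x̄) - Z(0̄ θ_δx̄)) ⟨σ_ȳσ_{θ_δȳ}⟩_{𝕋_L}`,
then `1 ≤ Σ_δ ( ⟨σ_{0̄}σ_{θ_δ0̄}⟩_{𝕋_L} + w κ Σ_{x,y ∈ Λ_n, y∼x} (⟨σ_{0̄}σ_{x̄}⟩ - ⟨σ_{0̄}σ_{θ_δ x̄}⟩) ⟨σ_ȳσ_{θ_δȳ}⟩ )`: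
the printed integration of (2.20)–(2.24) against `𝐏^∅_{𝕋_L}` consumes Lemma 2.5 only through the sum over
the pairs. [cite: DuminilCopinPanis2025LowerBounds, §2.2, eqs. (2.5)–(2.8) and (2.20)–(2.24)] -/
theorem torusIneq_of_lemma25_sum {d L : ℕ} [NeZero L] (hL : Even L) {n : ℕ} (hn : 1 ≤ n)
    (hnL : 4 * n + 2 ≤ L) {β : ℝ} (hβ : 0 ≤ β) {w : ℝ} (hw : 0 ≤ w) {κ : ℝ} (hκ : 0 ≤ κ)
    (hφ : ∀ S : Finset (Site d), (0 : Site d) ∈ S → S ⊆ box d (n - 1) →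
      1 ≤ w * ∑ x ∈ S, ((((zdGraph d).neighborFinset x).filter fun y => y ∉ S).card : ℝ) *
        isingTwoPoint (zdGraph d) S β 0 .free 0 x)
    (H25 : ∀ δ : Fin d × Bool,
      (∑ x ∈ box d n, ∑ y ∈ box d n,
        if (zdGraph d).Adj x y then
          ∑' nc : edgesIn (torusGraph d L) univ → ℕ,
            ind (csources (torusGraph d L) univ nc = ∅ ∧
                CSupp (torusGraph d L) univ (edgesIn (torusGraph d L) univ) nc) *
              cweight (torusGraph d L) univ β nc *
              (ind (¬ (isFoldable_dir hL (by omega) n δ).ConnFix ((isFoldable_dir hL (by omega) n δ).fold nc)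
                      (Torus.proj L (0 : Site d)) ∧
                    ¬ (isFoldable_dir hL (by omega) n δ).ConnFix ((isFoldable_dir hL (by omega) n δ).fold nc)
                      (Torus.proj L x) ∧
                    (isFoldable_dir hL (by omega) n δ).ConnFix ((isFoldable_dir hL (by omega) n δ).fold nc)
                      (Torus.proj L y)) *
                ENNReal.ofReal (isingTwoPoint (torusGraph d L)
                  (((box d n).filter fun z => ¬ (isFoldable_dir hL (by omega) n δ).ConnFix
                      ((isFoldable_dir hL (by omega) n δ).fold nc) (Torus.proj L z)).image (Torus.proj L))
                  β 0 .free (Torus.proj L (0 : Site d)) (Torus.proj L x)))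
        else 0) ≤
      ENNReal.ofReal κ *
        ∑ x ∈ box d n, ∑ y ∈ box d n,
          if (zdGraph d).Adj x y then
            (currentZ (torusGraph d L) univ β (edgesIn (torusGraph d L) univ)
                  ({Torus.proj L (0 : Site d)} ∆ {Torus.proj L x}) -
                currentZ (torusGraph d L) univ β (edgesIn (torusGraph d L) univ)
                  ({Torus.proj L (0 : Site d)} ∆ {dirTheta L n δ (Torus.proj L x)})) *
              ENNReal.ofReal (isingTwoPoint (torusGraph d L) univ β 0 .free (Torus.proj L y)
                (dirTheta L n δ (Torus.proj L y)))
          else 0) :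
    (1 : ℝ) ≤ ∑ δ : Fin d × Bool,
      (isingTwoPoint (torusGraph d L) univ β 0 .free (Torus.proj L 0) (Torus.proj L (dirRefl δ n 0)) +
        w * κ * ∑ x ∈ box d n, ∑ y ∈ box d n,
          if (zdGraph d).Adj x y then
            (isingTwoPoint (torusGraph d L) univ β 0 .free (Torus.proj L 0) (Torus.proj L x) -
                isingTwoPoint (torusGraph d L) univ β 0 .free (Torus.proj L 0) (Torus.proj L (dirRefl δ n x))) *
              isingTwoPoint (torusGraph d L) univ β 0 .free (Torus.proj L y) (Torus.proj L (dirRefl δ n y))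
          else 0) := by
  classical
  -- adapted from `DCPNearCritical.torusIneq_of_lemma25_weight` (SharpLengthDCPTorus.lean)
  -- notation
  set GT := torusGraph d L with hGT
  set E := edgesIn GT univ with hE
  have h2L : 2 < L := by omega
  set hD : ∀ δ : Fin d × Bool, IsFoldable GT (dirTheta L n δ) univ (dirHalf L n δ) :=
    fun δ => isFoldable_dir hL h2L n δ with hhD
  -- the connection predicates of a current and the random volumes
  set cT : (E → ℕ) → Fin d × Bool → Site d → Prop :=
    fun nc δ z => (hD δ).ConnFix ((hD δ).fold nc) (Torus.proj L z) with hcT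
  set Z : Finset (TorusSite d L) → ℝ≥0∞ := fun A => currentZ GT univ β E A with hZ
  set wt : (E → ℕ) → ℝ≥0∞ := fun nc => ind (csources GT univ nc = ∅ ∧ CSupp GT univ E nc) * cweight GT univ β nc with hwt
  set p0 := Torus.proj L (0 : Site d) with hp0
  -- face points are connected
  have hface : ∀ nc : E → ℕ, ∀ z ∈ box d n, ∀ i : Fin d,
      (z i = n → cT nc (i, true) z) ∧ (z i = -(n : ℤ) → cT nc (i, false) z) := by
    intro nc z hz i
    constructor
    · intro hzi
      refine ⟨Torus.proj L z, mem_univ _, dirTheta_proj_eq_self hL hnL hz (i, true) (by simpa [sgn] using hzi), ?_⟩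
      exact Relation.ReflTransGen.refl
    · intro hzi
      refine ⟨Torus.proj L z, mem_univ _, dirTheta_proj_eq_self hL hnL hz (i, false) (by simpa [sgn] using hzi), ?_⟩
      exact Relation.ReflTransGen.refl
  -- the pointwise inequality for every current
  set A : (E → ℕ) → ℝ := fun nc => ∑ δ : Fin d × Bool, if cT nc δ 0 then (1 : ℝ) else 0 with hA
  set B : (E → ℕ) → ℝ := fun nc => ∑ δ : Fin d × Bool, ∑ x ∈ box d n, ∑ y ∈ box d n,
    (if (zdGraph d).Adj x y ∧ ¬ cT nc δ 0 ∧ ¬ cT nc δ x ∧ cT nc δ y then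
      isingTwoPoint GT (((box d n).filter fun z => ¬ cT nc δ z).image (Torus.proj L)) β 0 .free p0 (Torus.proj L x)
    else 0) with hB
  have hpt : ∀ nc, (1 : ℝ) ≤ A nc + w * B nc := fun nc =>
    pointwise_master_weight (L := L) hn (by omega) hβ hw hφ (cT nc) (hface nc)
  have hA0 : ∀ nc, 0 ≤ A nc := fun nc => sum_nonneg fun δ _ => by split_ifs <;> norm_num
  have hB0 : ∀ nc, 0 ≤ B nc := fun nc =>
    sum_nonneg fun δ _ => sum_nonneg fun x hx => sum_nonneg fun y _ => ite_twoPoint_nonneg hβ (cT nc) δ hx y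
  -- Step 1: integrate the pointwise inequality against the sourceless current
  have hZdef : Z ∅ = ∑' nc, wt nc := rfl
  have step1 : Z ∅ ≤ ∑' nc, (wt nc * ENNReal.ofReal (A nc) + ENNReal.ofReal (w) * (wt nc * ENNReal.ofReal (B nc))) := by
    rw [hZdef]
    refine ENNReal.tsum_le_tsum fun nc => ?_
    have h1 : (1 : ℝ≥0∞) ≤ ENNReal.ofReal (A nc + w * B nc) := ENNReal.one_le_ofReal.2 (hpt nc)
    calc wt nc = wt nc * 1 := (mul_one _).symm
      _ ≤ wt nc * ENNReal.ofReal (A nc + w * B nc) := mul_le_mul_right h1 _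
      _ = wt nc * ENNReal.ofReal (A nc) + ENNReal.ofReal (w) * (wt nc * ENNReal.ofReal (B nc)) := by
          rw [ENNReal.ofReal_add (hA0 nc) (mul_nonneg hw (hB0 nc)), ENNReal.ofReal_mul hw]
          ring
  rw [ENNReal.tsum_add, ENNReal.tsum_mul_left] at step1
  -- Step 2: the first term and Lemma 2.4
  have hp0H : ∀ δ, p0 ∈ dirHalf L n δ := fun δ => proj_zero_mem_dirHalf hL hn hnL δ
  have step2 : ∑' nc, wt nc * ENNReal.ofReal (A nc) ≤ ∑ δ : Fin d × Bool, Z ({p0} ∆ {dirTheta L n δ p0}) := by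
    have hre : ∀ nc, wt nc * ENNReal.ofReal (A nc) = ∑ δ : Fin d × Bool, wt nc * ind (cT nc δ 0) := by
      intro nc
      rw [hA]
      simp only
      rw [ofReal_sum_ite_one, Finset.mul_sum]
    simp_rw [hre]
    rw [Summable.tsum_finsetSum (fun _ _ => ENNReal.summable)]
    refine Finset.sum_le_sum fun δ _ => ?_
    exact (hD δ).tsum_empty_connFix_le (hp0H δ) hβ
  -- Step 3: the triple sum and the SUMMED Lemma 2.5 with the gain `κ`
  set R : Fin d × Bool → Site d → Site d → ℝ≥0∞ := fun δ x y =>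
    if (zdGraph d).Adj x y then
      (Z ({p0} ∆ {Torus.proj L x}) - Z ({p0} ∆ {dirTheta L n δ (Torus.proj L x)})) *
        ENNReal.ofReal (isingTwoPoint GT univ β 0 .free (Torus.proj L y) (dirTheta L n δ (Torus.proj L y)))
    else 0 with hR
  have step3 : ∑' nc, wt nc * ENNReal.ofReal (B nc) ≤
      ENNReal.ofReal κ * ∑ δ : Fin d × Bool, ∑ x ∈ box d n, ∑ y ∈ box d n, R δ x y := by
    have hre : ∀ nc, wt nc * ENNReal.ofReal (B nc) = ∑ δ : Fin d × Bool, ∑ x ∈ box d n, ∑ y ∈ box d n,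
        wt nc * (ind ((zdGraph d).Adj x y ∧ ¬ cT nc δ 0 ∧ ¬ cT nc δ x ∧ cT nc δ y) *
          ENNReal.ofReal (isingTwoPoint GT (((box d n).filter fun z => ¬ cT nc δ z).image (Torus.proj L)) β 0 .free
            p0 (Torus.proj L x))) := by
      intro nc
      rw [hB]
      simp only
      rw [ENNReal.ofReal_sum_of_nonneg (fun δ _ => sum_nonneg fun x hx => sum_nonneg fun y _ =>
        ite_twoPoint_nonneg hβ (cT nc) δ hx y), Finset.mul_sum]
      refine Finset.sum_congr rfl fun δ _ => ?_
      rw [ENNReal.ofReal_sum_of_nonneg (fun x hx => sum_nonneg fun y _ => ite_twoPoint_nonneg hβ (cT nc) δ hx y),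
        Finset.mul_sum]
      refine Finset.sum_congr rfl fun x hx => ?_
      rw [ENNReal.ofReal_sum_of_nonneg (fun y _ => ite_twoPoint_nonneg hβ (cT nc) δ hx y), Finset.mul_sum]
      refine Finset.sum_congr rfl fun y _ => ?_
      rw [ofReal_ite_eq_ind_mul]
    simp_rw [hre]
    rw [Summable.tsum_finsetSum (fun _ _ => ENNReal.summable), Finset.mul_sum]
    refine Finset.sum_le_sum fun δ _ => ?_
    rw [Summable.tsum_finsetSum (fun _ _ => ENNReal.summable)]
    -- the sum over the pairs, with the non-neighbour terms vanishing, is the left side of `H25 δ`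
    refine le_trans (le_of_eq ?_) (H25 δ)
    refine Finset.sum_congr rfl fun x _ => ?_
    rw [Summable.tsum_finsetSum (fun _ _ => ENNReal.summable)]
    refine Finset.sum_congr rfl fun y _ => ?_
    by_cases hxy : (zdGraph d).Adj x y
    · rw [if_pos hxy]
      refine tsum_congr fun nc => ?_
      rw [ind_congr (show ((zdGraph d).Adj x y ∧ ¬ cT nc δ 0 ∧ ¬ cT nc δ x ∧ cT nc δ y) ↔
        (¬ cT nc δ 0 ∧ ¬ cT nc δ x ∧ cT nc δ y) from ⟨fun h => h.2, fun h => ⟨hxy, h⟩⟩)]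
    · rw [if_neg hxy]
      refine ENNReal.tsum_eq_zero.2 fun nc => ?_
      rw [ind_of_false (fun h => hxy h.1), zero_mul, mul_zero]
  -- Step 4: the inequality in `ℝ≥0∞`, with the effective weight `w κ`
  have hwκ : 0 ≤ w * κ := mul_nonneg hw hκ
  have step4 : Z ∅ ≤ ∑ δ : Fin d × Bool, Z ({p0} ∆ {dirTheta L n δ p0}) +
      ENNReal.ofReal (w * κ) * ∑ δ : Fin d × Bool, ∑ x ∈ box d n, ∑ y ∈ box d n, R δ x y := by
    rw [ENNReal.ofReal_mul hw, mul_assoc]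
    exact step1.trans (add_le_add step2 (mul_le_mul_right step3 _))
  set w' : ℝ := w * κ with hw'def
  -- Step 5: to real numbers
  have hfin : ∀ A', Z A' ≠ ∞ := fun A' => currentZ_univ_ne_top GT hβ A'
  have hZ1 : 1 ≤ Z ∅ := one_le_currentZ_univ_empty GT β
  set z0 : ℝ := (Z ∅).toReal with hz0def
  have hz0 : 0 < z0 := ENNReal.toReal_pos (ne_of_gt (lt_of_lt_of_le zero_lt_one hZ1)) (hfin ∅)
  have hdict : ∀ a b, isingTwoPoint GT univ β 0 .free a b = (Z ({a} ∆ {b})).toReal / z0 := fun a b =>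
    isingTwoPoint_univ_eq_currentZ_div GT hβ a b
  have hdict' : ∀ a b, (Z ({a} ∆ {b})).toReal = z0 * isingTwoPoint GT univ β 0 .free a b := fun a b => by
    rw [hdict, mul_div_cancel₀ _ hz0.ne']
  have Hle : ∀ δ : Fin d × Bool, ∀ x ∈ box d n,
      Z ({p0} ∆ {dirTheta L n δ (Torus.proj L x)}) ≤ Z ({p0} ∆ {Torus.proj L x}) :=
    fun δ x hx => hle_torus hL hn hnL hβ δ hx
  have hRfin : ∀ δ x y, R δ x y ≠ ∞ := by
    intro δ x y
    rw [hR]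
    simp only
    split_ifs
    · exact ENNReal.mul_ne_top (ENNReal.sub_ne_top (hfin _)) ENNReal.ofReal_ne_top
    · exact ENNReal.zero_ne_top
  have hRreal : ∀ δ, ∀ x ∈ box d n, ∀ y, (R δ x y).toReal =
      if (zdGraph d).Adj x y then
        ((Z ({p0} ∆ {Torus.proj L x})).toReal - (Z ({p0} ∆ {dirTheta L n δ (Torus.proj L x)})).toReal) *
          isingTwoPoint GT univ β 0 .free (Torus.proj L y) (dirTheta L n δ (Torus.proj L y))
      else 0 := by
    intro δ x hx y
    rw [hR]
    simp only
    split_ifs with hxy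
    · rw [ENNReal.toReal_mul, ENNReal.toReal_sub_of_le (Hle δ x hx) (hfin _),
        ENNReal.toReal_ofReal (isingTwoPoint_free_nonneg_of_mem _ hβ (mem_univ _) (mem_univ _))]
    · rfl
  have hsumfin : ∀ δ : Fin d × Bool, ∑ x ∈ box d n, ∑ y ∈ box d n, R δ x y ≠ ∞ := fun δ =>
    ENNReal.sum_ne_top.2 fun x _ => ENNReal.sum_ne_top.2 fun y _ => hRfin δ x y
  have hRHSfin : ∑ δ : Fin d × Bool, Z ({p0} ∆ {dirTheta L n δ p0}) +
      ENNReal.ofReal (w') * ∑ δ : Fin d × Bool, ∑ x ∈ box d n, ∑ y ∈ box d n, R δ x y ≠ ∞ :=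
    ENNReal.add_ne_top.2 ⟨ENNReal.sum_ne_top.2 fun δ _ => hfin _,
      ENNReal.mul_ne_top ENNReal.ofReal_ne_top (ENNReal.sum_ne_top.2 fun δ _ => hsumfin δ)⟩
  have step5 : z0 ≤ ∑ δ : Fin d × Bool, (Z ({p0} ∆ {dirTheta L n δ p0})).toReal +
      w' * ∑ δ : Fin d × Bool, ∑ x ∈ box d n, ∑ y ∈ box d n, (R δ x y).toReal := by
    have h := ENNReal.toReal_mono hRHSfin step4
    rw [ENNReal.toReal_add (ENNReal.sum_ne_top.2 fun δ _ => hfin _)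
        (ENNReal.mul_ne_top ENNReal.ofReal_ne_top (ENNReal.sum_ne_top.2 fun δ _ => hsumfin δ)),
      ENNReal.toReal_sum (fun δ _ => hfin _), ENNReal.toReal_mul, ENNReal.toReal_ofReal hwκ,
      ENNReal.toReal_sum (fun δ _ => hsumfin δ)] at h
    refine h.trans (le_of_eq ?_)
    congr 1
    congr 1
    refine Finset.sum_congr rfl fun δ _ => ?_
    rw [ENNReal.toReal_sum (fun x _ => ENNReal.sum_ne_top.2 fun y _ => hRfin δ x y)]
    refine Finset.sum_congr rfl fun x _ => ?_
    exact ENNReal.toReal_sum (fun y _ => hRfin δ x y)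
  -- Step 6: divide by `Z(∅)` and identify the two-point functions
  have hθ0 : ∀ δ : Fin d × Bool, dirTheta L n δ p0 = Torus.proj L (dirRefl δ n 0) := fun δ => dirTheta_proj n δ 0
  have h1 : ∀ δ : Fin d × Bool, (Z ({p0} ∆ {dirTheta L n δ p0})).toReal =
      z0 * isingTwoPoint GT univ β 0 .free p0 (Torus.proj L (dirRefl δ n 0)) := fun δ => by
    rw [hθ0 δ, hdict']
  have h2 : ∀ δ : Fin d × Bool, ∑ x ∈ box d n, ∑ y ∈ box d n, (R δ x y).toReal =
      z0 * ∑ x ∈ box d n, ∑ y ∈ box d n,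
        (if (zdGraph d).Adj x y then
          (isingTwoPoint GT univ β 0 .free p0 (Torus.proj L x) -
              isingTwoPoint GT univ β 0 .free p0 (Torus.proj L (dirRefl δ n x))) *
            isingTwoPoint GT univ β 0 .free (Torus.proj L y) (Torus.proj L (dirRefl δ n y))
        else 0) := by
    intro δ
    rw [Finset.mul_sum]
    refine Finset.sum_congr rfl fun x hx => ?_
    rw [Finset.mul_sum]
    refine Finset.sum_congr rfl fun y _ => ?_
    rw [hRreal δ x hx y]
    split_ifs with hxy
    · rw [hdict' p0 (Torus.proj L x), dirTheta_proj n δ x, hdict', dirTheta_proj n δ y]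
      ring
    · rw [mul_zero]
  simp only [h1, h2] at step5
  rw [← Finset.mul_sum, ← Finset.mul_sum, ← mul_assoc, mul_comm (w') z0, mul_assoc, ← mul_add] at step5
  have hfinal : (1 : ℝ) ≤ ∑ δ : Fin d × Bool, isingTwoPoint GT univ β 0 .free p0 (Torus.proj L (dirRefl δ n 0)) +
      w' * ∑ δ : Fin d × Bool, ∑ x ∈ box d n, ∑ y ∈ box d n,
        (if (zdGraph d).Adj x y then
          (isingTwoPoint GT univ β 0 .free p0 (Torus.proj L x) -
              isingTwoPoint GT univ β 0 .free p0 (Torus.proj L (dirRefl δ n x))) *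
            isingTwoPoint GT univ β 0 .free (Torus.proj L y) (Torus.proj L (dirRefl δ n y))
        else 0) := by
    nth_rewrite 1 [← mul_one z0] at step5
    exact le_of_mul_le_mul_left step5 hz0
  rw [Finset.mul_sum, ← Finset.sum_add_distrib] at hfinal
  exact hfinal

/-- **The infinite-volume inequality from the SUMMED Lemma 2.5 with a gain `κ`** (adapted from the
tree's `DCPNearCritical.infiniteVolume_ineq_of_lemma25`; "We conclude by taking `Λ ↗ ℤ^d`", end of the
proof of Lemma 2.5, here along the even tori `L = 2k + 2`): for `β ≥ 0` with `m*(β) = 0`, `n ≥ 1`, a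
weight `w ≥ 0` satisfying the boundary input inside `Λ_{n-1}`, and Lemma 2.5 in current form SUMMED over
the neighbour pairs of `Λ_n` with the factor `κ ≥ 0`, on every even torus of side `L ≥ 4n + 2` and in
every direction,
`1 ≤ Σ_δ ( ⟨σ₀σ_{𝓡_δ(0)}⟩_β + w κ Σ_{x,y ∈ Λ_n, y ∼ x} (⟨σ₀σ_x⟩_β - ⟨σ₀σ_{𝓡_δ(x)}⟩_β) ⟨σ₀σ_{𝓡_δ(y) - y}⟩_β )`
for the free infinite-volume two-point function. [cite: DuminilCopinPanis2025LowerBounds, §2.2, eqs. (2.5)–(2.8) with Lemmas 2.4–2.5] -/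
theorem infiniteVolume_ineq_of_lemma25_sum {d : ℕ} {β : ℝ} (hβ : 0 ≤ β)
    (hm : spontaneousMagnetization d β = 0) {n : ℕ} (hn : 1 ≤ n) {w : ℝ} (hw : 0 ≤ w) {κ : ℝ} (hκ : 0 ≤ κ)
    (hφ : ∀ S : Finset (Site d), (0 : Site d) ∈ S → S ⊆ box d (n - 1) →
      1 ≤ w * ∑ x ∈ S, ((((zdGraph d).neighborFinset x).filter fun y => y ∉ S).card : ℝ) *
        isingTwoPoint (zdGraph d) S β 0 .free 0 x)
    (H25 : ∀ (L : ℕ) [NeZero L] (hL : Even L) (hnL : 4 * n + 2 ≤ L) (δ : Fin d × Bool),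
      (∑ x ∈ box d n, ∑ y ∈ box d n,
        if (zdGraph d).Adj x y then
          ∑' nc : edgesIn (torusGraph d L) univ → ℕ,
            ind (csources (torusGraph d L) univ nc = ∅ ∧
                CSupp (torusGraph d L) univ (edgesIn (torusGraph d L) univ) nc) *
              cweight (torusGraph d L) univ β nc *
              (ind (¬ (isFoldable_dir hL (by omega) n δ).ConnFix ((isFoldable_dir hL (by omega) n δ).fold nc)
                      (Torus.proj L (0 : Site d)) ∧
                    ¬ (isFoldable_dir hL (by omega) n δ).ConnFix ((isFoldable_dir hL (by omega) n δ).fold nc)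
                      (Torus.proj L x) ∧
                    (isFoldable_dir hL (by omega) n δ).ConnFix ((isFoldable_dir hL (by omega) n δ).fold nc)
                      (Torus.proj L y)) *
                ENNReal.ofReal (isingTwoPoint (torusGraph d L)
                  (((box d n).filter fun z => ¬ (isFoldable_dir hL (by omega) n δ).ConnFix
                      ((isFoldable_dir hL (by omega) n δ).fold nc) (Torus.proj L z)).image (Torus.proj L))
                  β 0 .free (Torus.proj L (0 : Site d)) (Torus.proj L x)))
        else 0) ≤
      ENNReal.ofReal κ *
        ∑ x ∈ box d n, ∑ y ∈ box d n,
          if (zdGraph d).Adj x y then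
            (currentZ (torusGraph d L) univ β (edgesIn (torusGraph d L) univ)
                  ({Torus.proj L (0 : Site d)} ∆ {Torus.proj L x}) -
                currentZ (torusGraph d L) univ β (edgesIn (torusGraph d L) univ)
                  ({Torus.proj L (0 : Site d)} ∆ {dirTheta L n δ (Torus.proj L x)})) *
              ENNReal.ofReal (isingTwoPoint (torusGraph d L) univ β 0 .free (Torus.proj L y)
                (dirTheta L n δ (Torus.proj L y)))
          else 0) :
    (1 : ℝ) ≤ ∑ δ : Fin d × Bool, (twoPointFree d β (dirRefl δ n 0) +
      w * κ * ∑ x ∈ box d n, ∑ y ∈ box d n,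
        if (zdGraph d).Adj x y then
          (twoPointFree d β x - twoPointFree d β (dirRefl δ n x)) * twoPointFree d β (dirRefl δ n y - y)
        else 0) := by
  -- adapted from `DCPNearCritical.infiniteVolume_ineq_of_lemma25` (SharpLengthDCPTorus.lean)
  -- the even tori `L_k = 2k + 2`, `k ≥ 2n`
  set T : ℕ → Site d → Site d → ℝ := fun k a b =>
    isingTorusTwoPoint d (2 * k + 1 + 1) β 0 (Torus.proj (2 * k + 1 + 1) a) (Torus.proj (2 * k + 1 + 1) b) with hT
  have hlim : ∀ a b, Tendsto (fun k => T k a b) atTop (𝓝 (twoPointFree d β (b - a))) := fun a b =>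
    tendsto_isingTorusTwoPoint_even hβ hm a b
  have hT0 : ∀ b, Tendsto (fun k => T k 0 b) atTop (𝓝 (twoPointFree d β b)) := fun b => by
    simpa using hlim 0 b
  -- the torus inequality for `k ≥ 2n`
  have hk : ∀ k, 2 * n ≤ k → (1 : ℝ) ≤ ∑ δ : Fin d × Bool, (T k 0 (dirRefl δ n 0) +
      w * κ * ∑ x ∈ box d n, ∑ y ∈ box d n,
        if (zdGraph d).Adj x y then (T k 0 x - T k 0 (dirRefl δ n x)) * T k y (dirRefl δ n y) else 0) := by
    intro k hk
    have hL : Even (2 * k + 1 + 1) := ⟨k + 1, by ring⟩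
    have hnL : 4 * n + 2 ≤ 2 * k + 1 + 1 := by omega
    exact torusIneq_of_lemma25_sum hL hn hnL hβ hw hκ hφ (H25 _ hL hnL)
  -- termwise limits
  have hterm : ∀ δ x y, Tendsto (fun k => if (zdGraph d).Adj x y then
      (T k 0 x - T k 0 (dirRefl δ n x)) * T k y (dirRefl δ n y) else 0) atTop
      (𝓝 (if (zdGraph d).Adj x y then
        (twoPointFree d β x - twoPointFree d β (dirRefl δ n x)) * twoPointFree d β (dirRefl δ n y - y) else 0)) := by
    intro δ x y
    split_ifs
    · exact ((hT0 x).sub (hT0 _)).mul (hlim y _)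
    · exact tendsto_const_nhds
  have hsum : Tendsto (fun k => ∑ δ : Fin d × Bool, (T k 0 (dirRefl δ n 0) +
      w * κ * ∑ x ∈ box d n, ∑ y ∈ box d n,
        if (zdGraph d).Adj x y then (T k 0 x - T k 0 (dirRefl δ n x)) * T k y (dirRefl δ n y) else 0)) atTop
      (𝓝 (∑ δ : Fin d × Bool, (twoPointFree d β (dirRefl δ n 0) +
        w * κ * ∑ x ∈ box d n, ∑ y ∈ box d n,
          if (zdGraph d).Adj x y then
            (twoPointFree d β x - twoPointFree d β (dirRefl δ n x)) * twoPointFree d β (dirRefl δ n y - y)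
          else 0))) :=
    tendsto_finsetSum _ fun δ _ => (hT0 _).add
      ((tendsto_finsetSum _ fun x _ => tendsto_finsetSum _ fun y _ => hterm δ x y).const_mul (w * κ))
  exact ge_of_tendsto hsum (Filter.eventually_atTop.2 ⟨2 * n, hk⟩)

end DCPNearCritical

end Literature.Probability.LatticeModels

end
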